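import Summits.ResolutionOfSingularities.ResolutionOfSingularities.Theorems.HilbertSamuelEliminationSigmaMaxModificationsCorridor3SigmaMenuTiers
import HarnessLib

/-!
# [OURS · L1 W4.2] σ-LAYER — `Corridor3SigmaMenuTiersWF`: the (D1) socket discharge of `…SigmaMenuTiers` with a rank valued in ANY WELL-FOUNDED ORDER
# (the rank of record for (PROGRESS) is the LEXICOGRAPHIC `μ := lex(Λ, mass)`, `Λ = (3 − |K|, Wall, psum)` — res-L1-w42-plan-1 RULING v3.14-35 (HN);
# `…SigmaMenuTiers` p538677 typed `μ` ℕ-valued): `eventually_forall_not_live_of_exclusive_progress_wf`, `oldestLiveGroupDies_of_wf`,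
# `everyGroupDiesAlong_of_wf` — same hypotheses (OLDER)(FIN)(INJ)(SEAL)(PROGRESS)(NEUTRAL)(NOSTARVE), `μ : … → R` for `[Preorder R] [WellFoundedLT R]`
# (crux chain w42 `SigmaMaxModifications` stmt-ResolutionOfSingularities-18506 / conjunct `SigmaMaxModificationsCorridor3` stmt-ResolutionOfSingularities-19249;
# typer res-L1-type-o1 (OURS typer G4); `--supports stmt-…-19249 --as helper`, counted 0)

HONEST FRAMING. OURS proof bookkeeping, additive over `…SigmaMenuTiers` (p538677; its ℕ-valued lemmas stay, these are the `_wf` twins) and res-D-pv-060's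
(E8-T) sockets (`OldestLiveGroupDies`, `EveryGroupDiesAlong`, `everyGroupDiesAlong_of_oldestDies`, p536058). NOTHING here is a statement of H. Hironaka's
manuscript [Hironaka2017] nor of Cossart–Jannsen–Saito [CossartJannsenSaito2020]; no named fact; AI-typed, AI review is weaker than expert review.

THE ARGUMENT (scheme-free): while `g` is live and exclusive its rank never rises and drops strictly at the board-changing steps, which by (NOSTARVE) recur for
ever — the ranks AT the board-changing steps form a strictly decreasing sequence in a well-founded order (`WellFounded.not_rel_apply_succ`), impossible.
Instances: `R = ℕ`, `ℕ ×ₗ ℕ`, `(ℕ ×ₗ ℕ) ×ₗ ℕ`, … (`Prod.Lex` well-founded instances in Mathlib).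
-/

noncomputable section

set_option linter.dupNamespace false -- mandated namespace of this single-conjunct summit

open CategoryTheory AlgebraicGeometry TopologicalSpace
open Summit.ResolutionOfSingularities.ResolutionOfSingularities.Theorems.CampaignW42
open Literature.AlgebraicGeometry.Resolution Literature.RingTheory.HilbertSamuel

namespace Summit.ResolutionOfSingularities.ResolutionOfSingularities.Theorems.SigmaMaxModificationsCorridor3.Sigma

universe u

section DescentWF

/-- **EVENTUAL SEALED DEATH UNDER EXCLUSIVE PROGRESS, WELL-FOUNDED RANK** (twin of `eventually_forall_not_live_of_exclusive_progress` with `μ : ℕ → ι → R`,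
`R` any preorder with well-founded `<` — e.g. the lexicographic rank of record). [folklore] -/
theorem eventually_forall_not_live_of_exclusive_progress_wf {ι : Type*} {R : Type*} [Preorder R] [WellFoundedLT R] {L : ι → ℕ → Prop}
    {β : ι → ℕ} {μ : ℕ → ι → R} {changes : ℕ → Prop} {g : ι}
    (holder : ∀ g', β g' < β g → ∃ n₂, ∀ n, n₂ ≤ n → ¬ L g' n)
    (hfin : {g' | β g' < β g ∧ ∃ n, L g' n}.Finite)
    (hinj : ∀ g', (∃ n, L g' n) → β g' = β g → g' = g)
    (hseal : ∀ n, (∃ m, m ≤ n ∧ L g m) → ¬ L g n → ¬ L g (n + 1))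
    (hprog : ∀ n, (∀ g', g' ≠ g → β g' ≤ β g → ¬ L g' n) → L g n → L g (n + 1) → changes n → μ (n + 1) g < μ n g)
    (hneut : ∀ n, (∀ g', g' ≠ g → β g' ≤ β g → ¬ L g' n) → L g n → L g (n + 1) → ¬ changes n → μ (n + 1) g ≤ μ n g)
    (hnostarve : ∀ n₀, ¬ ∀ n, n₀ ≤ n → (∀ g', g' ≠ g → β g' ≤ β g → ¬ L g' n) ∧ L g n ∧ ¬ changes n) :
    ∃ n₂, ∀ n, n₂ ≤ n → ¬ L g n := by
  classical
  -- a stage beyond which `g` is exclusive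
  have holder' : ∀ g' : ι, ∃ n₂, β g' < β g → ∀ n, n₂ ≤ n → ¬ L g' n := fun g' => by
    by_cases h : β g' < β g
    · obtain ⟨n₂, hn₂⟩ := holder g' h
      exact ⟨n₂, fun _ => hn₂⟩
    · exact ⟨0, fun h' => absurd h' h⟩
  choose T hT using holder'
  obtain ⟨n₁, hn₁⟩ : ∃ n₁, ∀ n, n₁ ≤ n → ∀ g', g' ≠ g → β g' ≤ β g → ¬ L g' n := by
    refine ⟨hfin.toFinset.sup T, fun n hn g' hne hle hL => ?_⟩
    rcases hle.lt_or_eq with hlt | heq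
    · exact hT g' hlt n ((Finset.le_sup (hfin.mem_toFinset.mpr ⟨hlt, n, hL⟩)).trans hn) hL
    · exact hne (hinj g' ⟨n, hL⟩ heq)
  by_cases hever : ∃ m, L g m
  swap
  · exact ⟨0, fun n _ hL => hever ⟨n, hL⟩⟩
  obtain ⟨m₀, hm₀⟩ := hever
  set n₂ := max n₁ m₀ with hn₂
  -- `g` cannot be live at every stage from `n₂` on
  have hdead : ∃ n, n₂ ≤ n ∧ ¬ L g n := by
    by_contra! hlive
    set a : ℕ → R := fun i => μ (n₂ + i) g with ha
    have hexcl : ∀ i, ∀ g', g' ≠ g → β g' ≤ β g → ¬ L g' (n₂ + i) := fun i => hn₁ _ ((le_max_left _ _).trans (Nat.le_add_right _ _))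
    have hL : ∀ i, L g (n₂ + i) := fun i => hlive _ (Nat.le_add_right _ _)
    have hstep : ∀ i, a (i + 1) ≤ a i := fun i => by
      by_cases hc : changes (n₂ + i)
      · exact (hprog _ (hexcl i) (hL i) (hL (i + 1)) hc).le
      · exact hneut _ (hexcl i) (hL i) (hL (i + 1)) hc
    have hanti : Antitone a := antitone_nat_of_succ_le hstep
    -- beyond every index there is a board-changing step, i.e. a strict drop of `a`
    have hchange : ∀ i, ∃ j, i ≤ j ∧ a (j + 1) < a j := fun i => by
      by_contra! hno
      refine hnostarve (n₂ + i) fun n hn => ⟨hn₁ n ((le_max_left _ _).trans ((Nat.le_add_right _ _).trans hn)), hlive n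
        ((Nat.le_add_right _ _).trans hn), fun hc => ?_⟩
      obtain ⟨d, rfl⟩ := Nat.exists_eq_add_of_le hn
      have hlt := hprog _ (hexcl (i + d)) (hL (i + d)) (hL (i + d + 1)) (by simpa [Nat.add_assoc] using hc)
      have hle := hno (i + d) (Nat.le_add_right _ _)
      simp only [ha, Nat.add_assoc] at hle hlt
      exact hle hlt
    -- the drop times, and the strictly decreasing sequence of ranks at them
    choose J hJle hJlt using hchange
    let t : ℕ → ℕ := fun k => Nat.rec 0 (fun _ tk => J tk + 1) k
    have ht : ∀ k, t (k + 1) = J (t k) + 1 := fun _ => rfl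
    have hdec : ∀ k, a (t (k + 1)) < a (t k) := fun k => by
      rw [ht]
      exact (hJlt (t k)).trans_le (hanti (hJle (t k)))
    obtain ⟨k, hk⟩ := WellFounded.not_rel_apply_succ (r := (· < ·)) fun k => a (t k)
    exact hk (hdec k)
  -- once dead (having lived), dead for ever
  obtain ⟨n, hn, hdn⟩ := hdead
  refine ⟨n, fun k hk => ?_⟩
  induction hk with
  | refl => exact hdn
  | step hle ih => exact hseal _ ⟨m₀, (le_max_right _ _ |>.trans hn).trans hle, hm₀⟩ ih

variable {ι : Type} {σ : StrategyE.{u}} {N : ℕ} {ν : ℕ → ℕ} {s₀ : MarkedStageE.{u}} {GLive : ι → MarkedStageE.{u} → Prop} {β : ι → ℕ}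
  {R : Type*} [Preorder R] [WellFoundedLT R]

/-- **THE (D1) SOCKET `OldestLiveGroupDies` FROM THE INSTANCES' INPUTS, WELL-FOUNDED RANK** (twin of `oldestLiveGroupDies_of` with `μ : MarkedStageE → ι → R`;
for the rank of record take `R := (ℕ ×ₗ ℕ ×ₗ ℕ) ×ₗ ℕ`, `μ := (Λ, mass)`, RULING v3.14-35 (HN)). [folklore] -/
theorem oldestLiveGroupDies_of_wf (μ : MarkedStageE.{u} → ι → R) (changes : (ℕ → MarkedStageE.{u}) → ι → ℕ → Prop)
    (hfin : ∀ c, IsChainFromσE σ N ν s₀ c → ∀ g : ι, {g' | β g' < β g ∧ ∃ n, GLive g' (c n)}.Finite)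
    (hinj : ∀ c, IsChainFromσE σ N ν s₀ c → ∀ g g' : ι, (∃ n, GLive g' (c n)) → β g' = β g → g' = g)
    (hseal : ∀ c, IsChainFromσE σ N ν s₀ c → ∀ (g : ι) (n : ℕ), (∃ m, m ≤ n ∧ GLive g (c m)) → ¬ GLive g (c n) → ¬ GLive g (c (n + 1)))
    (hprog : ∀ c, IsChainFromσE σ N ν s₀ c → ∀ (g : ι) (n : ℕ), (∀ g', g' ≠ g → β g' ≤ β g → ¬ GLive g' (c n)) →
      GLive g (c n) → GLive g (c (n + 1)) → changes c g n → μ (c (n + 1)) g < μ (c n) g)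
    (hneut : ∀ c, IsChainFromσE σ N ν s₀ c → ∀ (g : ι) (n : ℕ), (∀ g', g' ≠ g → β g' ≤ β g → ¬ GLive g' (c n)) →
      GLive g (c n) → GLive g (c (n + 1)) → ¬ changes c g n → μ (c (n + 1)) g ≤ μ (c n) g)
    (hnostarve : ∀ c, IsChainFromσE σ N ν s₀ c → ∀ (g : ι) (n₀ : ℕ),
      ¬ ∀ n, n₀ ≤ n → (∀ g', g' ≠ g → β g' ≤ β g → ¬ GLive g' (c n)) ∧ GLive g (c n) ∧ ¬ changes c g n) :
    OldestLiveGroupDies σ N ν s₀ GLive β :=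
  fun c hc g holder =>
    eventually_forall_not_live_of_exclusive_progress_wf (L := fun g n => GLive g (c n)) (μ := fun n g => μ (c n) g)
      (changes := changes c g) holder (hfin c hc g) (hinj c hc g) (hseal c hc g) (hprog c hc g) (hneut c hc g) (hnostarve c hc g)

/-- **… hence (D2) `EveryGroupDiesAlong`, well-founded rank** (∘ 060's `everyGroupDiesAlong_of_oldestDies`). [folklore] -/
theorem everyGroupDiesAlong_of_wf (μ : MarkedStageE.{u} → ι → R) (changes : (ℕ → MarkedStageE.{u}) → ι → ℕ → Prop)
    (hfin : ∀ c, IsChainFromσE σ N ν s₀ c → ∀ g : ι, {g' | β g' < β g ∧ ∃ n, GLive g' (c n)}.Finite)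
    (hinj : ∀ c, IsChainFromσE σ N ν s₀ c → ∀ g g' : ι, (∃ n, GLive g' (c n)) → β g' = β g → g' = g)
    (hseal : ∀ c, IsChainFromσE σ N ν s₀ c → ∀ (g : ι) (n : ℕ), (∃ m, m ≤ n ∧ GLive g (c m)) → ¬ GLive g (c n) → ¬ GLive g (c (n + 1)))
    (hprog : ∀ c, IsChainFromσE σ N ν s₀ c → ∀ (g : ι) (n : ℕ), (∀ g', g' ≠ g → β g' ≤ β g → ¬ GLive g' (c n)) →
      GLive g (c n) → GLive g (c (n + 1)) → changes c g n → μ (c (n + 1)) g < μ (c n) g)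
    (hneut : ∀ c, IsChainFromσE σ N ν s₀ c → ∀ (g : ι) (n : ℕ), (∀ g', g' ≠ g → β g' ≤ β g → ¬ GLive g' (c n)) →
      GLive g (c n) → GLive g (c (n + 1)) → ¬ changes c g n → μ (c (n + 1)) g ≤ μ (c n) g)
    (hnostarve : ∀ c, IsChainFromσE σ N ν s₀ c → ∀ (g : ι) (n₀ : ℕ),
      ¬ ∀ n, n₀ ≤ n → (∀ g', g' ≠ g → β g' ≤ β g → ¬ GLive g' (c n)) ∧ GLive g (c n) ∧ ¬ changes c g n) :
    EveryGroupDiesAlong σ N ν s₀ GLive :=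
  everyGroupDiesAlong_of_oldestDies β (oldestLiveGroupDies_of_wf μ changes hfin hinj hseal hprog hneut hnostarve)

end DescentWF

end Summit.ResolutionOfSingularities.ResolutionOfSingularities.Theorems.SigmaMaxModificationsCorridor3.Sigma

end
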